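import Literature.NumberTheory.QuadraticFields.QuadraticOrderLatticeDecomposition
import Mathlib.LinearAlgebra.Matrix.Determinant.Basic
import Mathlib.LinearAlgebra.Matrix.NonsingularInverse
import HarnessLib

/-!
# The Borevich–Faddeev normal form of a lattice over a quadratic order: the chain of orders
# `R(I₁) ⊆ ⋯ ⊆ R(Iₙ)` and the product class `[I₁⋯Iₙ]`
# (Jordan–Keeton–Poonen–Rains–Shepherd-Barron–Tate 2018, Thm. 3.2 (1) with the chain, and (2))

Topic `Literature/NumberTheory/QuadraticFields`, namespace
`Literature.NumberTheory.QuadraticFields.QuadraticOrderLattice`.  Family `hodge`, lane `lit-hodgefound`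
(Track 2 foundations library), seat p18 gen 12, row g12-#1, FILE 1 (pure algebra).  Sequel of
`QuadraticOrderLatticeDecomposition` (seat p18 gen 11: a lattice over a quadratic order is a direct
sum of rank-one lattices `L = I₁y₁ ⊕ ⋯ ⊕ Iₙyₙ` — JKPRST Thm. 3.2 (1), existence only), whose module
docstring left as `TODO(general form)` exactly what is done here and in FILE 2
(`QuadraticOrderLatticeClassification`): the CHAIN condition on the orders, the invariance of the
product class, the standard form and the classification.  THEOREMS ONLY — no definition, no named
fact (D-0026; net Literature debt 0).

## Source, VERBATIM

B. W. Jordan, A. G. Keeton, B. Poonen, E. M. Rains, N. Shepherd-Barron, J. T. Tate, *Abelian varieties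
isogenous to a power of an elliptic curve*, Compositio Math. 154 (2018) 934–959
[JKPRST2018IsogenousPowerElliptic] (held text `paper:arxiv-1602.06237`, p. 6), §3.2:

> **Theorem 3.2.** Let `R` be a quadratic order, i.e., an order in a degree `2` extension `K` of `ℚ`.
> Let `M` be a f.p. torsion-free `R`-module. • There exists a unique chain of orders `R₁ ⊆ ⋯ ⊆ Rₙ`
> between `R` and `K` and invertible ideals `I₁, …, Iₙ` of `R₁, …, Rₙ`, respectively, such that
> `M ≅ I₁ ⊕ ⋯ ⊕ Iₙ` as an `R`-module. • The `Iᵢ` are not unique, but their product `I₁⋯Iₙ` is an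
> invertible `Rₙ`-ideal whose class `[M] ∈ Pic Rₙ` depends only on `M`. • The isomorphism type of `M`
> is uniquely determined by the chain `R₁ ⊆ ⋯ ⊆ Rₙ` and the class `[M] ∈ Pic Rₙ`. *Proof.* See
> [Borevich–Faddeev 1960]. For generalizations to other integral domains, see [Bass 1963],
> [Borevich–Faddeev 1965], [Levy 1985], and the survey article [Salce 2002].

The printed proofs (Z. I. Borevich, D. K. Faddeev, Vestnik Leningrad. Univ. 15 (1960); H. Bass,
*Torsion free and projective modules*, Trans. AMS 102 (1962) / Math. Z. 82 (1963) §7) are NOT held —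
DECLARED DEVIATION: the proofs below are elementary arguments written for this file on the carriers
of `QuadraticOrderLatticeDecomposition` (whose `exists_good_vector` / `exists_splitting` /
`multiplier_eq_span_one_pair` are consumed BY NAME), with Cox's Prop. 7.4 in p01's form
`QuadraticLattice.exists_mul_eq_div_self` (every rank-two lattice of a quadratic field is invertible
for its own order `(I : I)`).

## Carriers (as in the gen-11 file; no new definition)

`K` is a field with `[K : ℚ] = 2` where needed (§1, §5), `V`, `V′` are `K`-vector spaces, a lattice is
a finitely generated `L : Submodule ℤ V` stable under ONE irrational `θ₀ ∈ K`; the rank-one pieces are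
`Iᵢ = Submodule.span ℤ {αᵢ, βᵢ} ⊆ K`; the ORDER of a lattice `I ⊆ K` is Mathlib's submodule quotient
`I / I = {x : xI ⊆ I}` (`Submodule.mem_div_iff_forall_mul_mem`), the multiplier order `R(L)` of
`L ⊆ V` is the predicate `∀ v ∈ L, x • v ∈ L`; a decomposition is the statement
`v ∈ L ↔ ∃ c : Fin n → K, (∀ i, c i ∈ I i) ∧ v = Σ cᵢ • yᵢ` with `y` `K`-independent; an isomorphism
`L ≅ L′` of lattices is a `K`-linear `f : V →ₗ[K] V′` (injective where needed) with
`L.map f = L′` — the rational extension of a module isomorphism.  "Same class in `Pic Rₙ`" for two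
lattices `P, P′ ⊆ K` with the same order reads `P′ = d • P`, `d ∈ K^×`.

## What is formalised

* §1 **Thm. 3.2 (1) WITH THE CHAIN** (`exists_chain_decomposition`, §5): the gen-11 induction re-run
  while tracking orders — `L = ⊕ Iᵢyᵢ` with `(I₁ : I₁) ⊆ (I₂ : I₂) ⊆ ⋯ ⊆ (Iₙ : Iₙ)` and `R(L) ⊆ (Iᵢ : Iᵢ)`
  for all `i`; with `forall_smul_mem_iff_forall_mem_div` (`R(L) = ⋂ᵢ (Iᵢ : Iᵢ)` for ANY decomposition)
  this gives **`R(L) = R₁`** (`forall_smul_mem_iff_mem_div_first`).  Mechanism: the first piece is the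
  good vector's coefficient lattice `I_m` with `R(I_m) = R(L) = ℤ + ℤθ`, and the complement `L₂` is
  `θ`-stable, so `R(L) ⊆ R(L₂) = R(I₂)` inductively.
* §2 **the determinant lattice** (any field `K`): `ℤ·{det C : C has its i-th row in Iᵢ} = I₁⋯Iₙ`
  (`span_det_eq_prod`: Leibniz for `⊆`, diagonal matrices for `⊇`), hence
  **`J₁⋯Jₙ = det(A)·I₁⋯Iₙ`** whenever the coefficient vectors for the `Jᵢ` are the `A`-images of those
  for the `Iᵢ` (`prod_eq_det_smul_prod`); `det A ≠ 0` as soon as all `Jᵢ ≠ 0`.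
* §3 **orders of products** (any field): the product of a chain of orders is its largest member
  (`prod_eq_last_of_chain`); for lattices `Iᵢ` invertible for their orders `(Iᵢ : Iᵢ)` forming a chain,
  **`(I₁⋯Iₙ)(𝔫₁⋯𝔫ₙ) = Rₙ` and `(I₁⋯Iₙ : I₁⋯Iₙ) = Rₙ`** (`prod_mul_prod_eq_last_and_div_self_prod`) — the
  first half of Thm. 3.2 (2).
* §4 **transport** (any field): what a `K`-linear `f` with `f(L) = L′` does to coefficient vectors
  (`coeff_iff_of_map_eq`), whence **Thm. 3.2 (2), invariance: `J₁⋯Jₙ = det(A)·I₁⋯Iₙ`**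
  (`exists_prod_eq_det_smul_prod_of_map_eq`) and the invariance of `R(L)` (`forall_smul_mem_map_iff`).
* §5 **assembly for quadratic orders**: `exists_chain_decomposition`; `exists_prod_mul_eq_last`
  (`I₁⋯Iₙ` invertible over `Rₙ = (I₁⋯Iₙ : I₁⋯Iₙ)`, via Cox 7.4); `exists_prod_eq_smul_prod_of_map_eq`
  (`J₁⋯Jₙ = d·I₁⋯Iₙ`, `d ≠ 0`, so `Rₙ(L′) = Rₙ(L)` and `[J₁⋯Jₙ] = [I₁⋯Iₙ]`); `div_first_eq_of_map_eq`
  (`R₁(L′) = R₁(L)`).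

NOT here: the standard form `L ≅ R₁ ⊕ ⋯ ⊕ Rₙ₋₁ ⊕ I₁⋯Iₙ`, «chain + class ⟹ isomorphism type» and the
uniqueness of the whole chain (Thm. 3.2 (1) uniqueness, (3)) — FILE 2 `QuadraticOrderLatticeClassification`.

## References
* [JKPRST2018IsogenousPowerElliptic] Jordan–Keeton–Poonen–Rains–Shepherd-Barron–Tate, Compositio
  Math. 154 (2018), §3.2 Thm. 3.2, p. 6 (= arXiv:1602.06237).
* [Cox2013] D. A. Cox, *Primes of the form x² + ny²*, 2nd ed., §7.A Prop. 7.4, pp. 134–136.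
* Z. I. Borevich, D. K. Faddeev, Vestnik Leningrad. Univ. 15 (1960) no. 19, 125–130 (not held);
  H. Bass, Trans. Amer. Math. Soc. 102 (1962) 319–327 and Math. Z. 82 (1963) 8–28, §7 (not held);
  S. Marseglia, *Computing abelian varieties over finite fields isogenous to a power*, Res. Number
  Theory 5 (2019), Thm. 2.3 (the Bass-order form of the statement; held `paper:arxiv-1808.03673` p. 4).
-/

noncomputable section

open Module Submodule
open scoped Pointwise

namespace Literature.NumberTheory.QuadraticFields

namespace QuadraticOrderLattice

/-! ## §0. Bookkeeping -/

section Bookkeeping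

variable {K : Type*} [Field K] [CharZero K]
variable {V : Type*} [AddCommGroup V] [Module K V]

/-- A `ℤ`-submodule of a finitely generated `ℤ`-module is finitely generated. [folklore] -/
private theorem fg_of_le' {M : Type*} [AddCommGroup M] {N L : Submodule ℤ M} (hNL : N ≤ L)
    (hL : L.FG) : N.FG := by
  haveI : IsNoetherian ℤ L := isNoetherian_of_fg_of_noetherian _ hL
  have h : (N.comap L.subtype).FG := IsNoetherian.noetherian _
  have hmap : (N.comap L.subtype).map L.subtype = N := by
    rw [Submodule.map_comap_subtype, inf_eq_right.2 hNL]
  rw [← hmap]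
  exact h.map _

omit [CharZero K] in
/-- The `K`-action of an integer is the `ℤ`-action. [folklore] -/
private theorem intCast_smul_eq' (n : ℤ) (v : V) : ((n : ℤ) : K) • v = n • v :=
  Int.cast_smul_eq_zsmul K n v

omit [CharZero K] in
/-- `ℤ + ℤθ` acts on a `θ`-stable lattice. [folklore] -/
private theorem smul_mem_of_mem_span_one_pair' {θ : K} {L : Submodule ℤ V}
    (hθL : ∀ v ∈ L, θ • v ∈ L) {x : K} (hx : x ∈ Submodule.span ℤ ({1, θ} : Set K)) {v : V}
    (hv : v ∈ L) : x • v ∈ L := by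
  obtain ⟨a, b, rfl⟩ := QuadraticLattice.mem_span_one_pair_iff.1 hx
  rw [add_smul, mul_smul, intCast_smul_eq', intCast_smul_eq']
  exact L.add_mem (L.smul_mem a hv) (L.smul_mem b (hθL v hv))

omit [CharZero K] in
/-- The multiplier order `R(L) = {x ∈ K : xL ⊆ L}` as a `ℤ`-submodule of `K`. [folklore] -/
private theorem exists_multiplier' (L : Submodule ℤ V) :
    ∃ O : Submodule ℤ K, ∀ x : K, x ∈ O ↔ ∀ v ∈ L, x • v ∈ L := by
  refine ⟨{ carrier := {x : K | ∀ v ∈ L, x • v ∈ L},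
            zero_mem' := fun v _ => by rw [zero_smul]; exact L.zero_mem,
            add_mem' := fun {x y} hx hy v hv => by
              rw [add_smul]; exact L.add_mem (hx v hv) (hy v hv),
            smul_mem' := fun n x hx v hv => by rw [smul_assoc]; exact L.smul_mem n (hx v hv) },
    fun x => Iff.rfl⟩

omit [CharZero K] in
/-- The `K`-span of a finitely generated `ℤ`-submodule is finite-dimensional. [folklore] -/
private theorem finiteDimensional_span_of_fg' {L : Submodule ℤ V} (hL : L.FG) :
    FiniteDimensional K (Submodule.span K (L : Set V)) := by
  obtain ⟨s, hs⟩ := hL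
  rw [← hs, Submodule.span_span_of_tower]
  exact FiniteDimensional.span_of_finite K s.finite_toSet

end Bookkeeping

/-! ## §1. The chain normal form `R(I₁) ⊆ R(I₂) ⊆ ⋯ ⊆ R(Iₙ)` (JKPRST Thm. 3.2 (1)) -/

section Chain

variable {K : Type*} [Field K] [CharZero K]
variable {V : Type*} [AddCommGroup V] [Module K V]

omit [CharZero K] in
/-- **The multiplier order of a decomposed lattice is the intersection of the orders of its
coefficient lattices**: if `v ∈ L ⟺ v = Σ cᵢyᵢ, cᵢ ∈ Iᵢ` (`y` `K`-independent), then
`xL ⊆ L ⟺ xIᵢ ⊆ Iᵢ` for every `i`. [cite: JKPRST2018IsogenousPowerElliptic, §3.2 Thm. 3.2, p. 6] -/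
theorem forall_smul_mem_iff_forall_mem_div {n : ℕ} {L : Submodule ℤ V} {y : Fin n → V}
    {I : Fin n → Submodule ℤ K} (hli : LinearIndependent K y)
    (hmem : ∀ v : V, v ∈ L ↔ ∃ c : Fin n → K, (∀ i, c i ∈ I i) ∧ v = ∑ i, c i • y i) (x : K) :
    (∀ v ∈ L, x • v ∈ L) ↔ ∀ i, x ∈ I i / I i := by
  classical
  constructor
  · intro hx i
    rw [Submodule.mem_div_iff_forall_mul_mem]
    intro a ha
    -- `a • y i ∈ L`, hence `x • (a • y i) = (x * a) • y i ∈ L`, so `x * a ∈ I i`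
    have hay : a • y i ∈ L := by
      refine (hmem _).2 ⟨Pi.single i a, fun j => ?_, ?_⟩
      · by_cases hj : j = i
        · subst hj; rwa [Pi.single_eq_same]
        · rw [Pi.single_eq_of_ne hj]; exact Submodule.zero_mem _
      · rw [Finset.sum_eq_single i (fun j _ hj => by rw [Pi.single_eq_of_ne hj, zero_smul])
          (fun h => (h (Finset.mem_univ i)).elim), Pi.single_eq_same]
    have hxay : (x * a) • y i ∈ L := by rw [mul_smul]; exact hx _ hay
    obtain ⟨c, hc, he⟩ := (hmem _).1 hxay
    have hz : ∀ j, c j - (Pi.single i (x * a) : Fin n → K) j = 0 := by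
      refine Fintype.linearIndependent_iff.1 hli (fun j => c j - (Pi.single i (x * a) : Fin n → K) j) ?_
      simp_rw [sub_smul, Finset.sum_sub_distrib, ← he]
      rw [Finset.sum_eq_single i, Pi.single_eq_same, sub_self]
      · intro j _ hj; rw [Pi.single_eq_of_ne hj, zero_smul]
      · intro hi; exact (hi (Finset.mem_univ i)).elim
    have hci : c i = x * a := by
      have := hz i
      rwa [Pi.single_eq_same, sub_eq_zero] at this
    rw [← hci]; exact hc i
  · intro hx v hv
    obtain ⟨c, hc, rfl⟩ := (hmem v).1 hv
    refine (hmem _).2 ⟨fun i => x * c i, fun i => ?_, ?_⟩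
    · exact (Submodule.mem_div_iff_forall_mul_mem.1 (hx i)) _ (hc i)
    · rw [Finset.smul_sum]
      simp_rw [mul_smul]

/-- The inductive statement behind `exists_chain_decomposition` (induction on `n = dim_K KL`):
the gen-11 decomposition re-run while tracking the multiplier orders — the first coefficient
lattice is the good vector's `I_m` with `R(I_m) = R(L)`, and `R(L) = ℤ + ℤθ ⊆ R(L₂)` because `L₂`
is `θ`-stable. [cite: JKPRST2018IsogenousPowerElliptic, §3.2 Thm. 3.2 (1), p. 6] -/
private theorem exists_chain_decomposition_aux (h2 : finrank ℚ K = 2) (n : ℕ) :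
    ∀ (L : Submodule ℤ V) (θ₀ : K), (∀ q : ℚ, (q : K) ≠ θ₀) → L.FG → (∀ v ∈ L, θ₀ • v ∈ L) →
      finrank K (Submodule.span K (L : Set V)) = n →
      ∃ (y : Fin n → V) (α β : Fin n → K),
        LinearIndependent K y ∧ (∀ i, y i ∈ L) ∧ (∀ i, LinearIndependent ℚ ![α i, β i]) ∧
        (∀ v : V, v ∈ L ↔ ∃ c : Fin n → K,
          (∀ i, c i ∈ Submodule.span ℤ ({α i, β i} : Set K)) ∧ v = ∑ i, c i • y i) ∧
        Submodule.span K (Set.range y) = Submodule.span K (L : Set V) ∧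
        (∀ i j : Fin n, i ≤ j →
          Submodule.span ℤ ({α i, β i} : Set K) / Submodule.span ℤ ({α i, β i} : Set K) ≤
            Submodule.span ℤ ({α j, β j} : Set K) / Submodule.span ℤ ({α j, β j} : Set K)) ∧
        (∀ (i : Fin n) (x : K), (∀ v ∈ L, x • v ∈ L) →
          x ∈ Submodule.span ℤ ({α i, β i} : Set K) / Submodule.span ℤ ({α i, β i} : Set K)) := by
  classical
  induction n with
  | zero =>
    intro L θ₀ hθ₀ hL hθ₀L hrank
    haveI := finiteDimensional_span_of_fg' (K := K) hL
    have hspan : Submodule.span K (L : Set V) = ⊥ := Submodule.finrank_eq_zero.1 hrank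
    have hL0 : ∀ v, v ∈ L ↔ v = 0 := by
      intro v
      constructor
      · intro hv
        have : v ∈ Submodule.span K (L : Set V) := Submodule.subset_span hv
        rw [hspan] at this
        exact (Submodule.mem_bot K).1 this
      · rintro rfl; exact L.zero_mem
    refine ⟨Fin.elim0, Fin.elim0, Fin.elim0, linearIndependent_empty_type, fun i => i.elim0,
      fun i => i.elim0, fun v => ?_, ?_, fun i => i.elim0, fun i => i.elim0⟩
    · rw [hL0]
      constructor
      · rintro rfl; exact ⟨Fin.elim0, fun i => i.elim0, by simp⟩
      · rintro ⟨c, -, rfl⟩; simp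
    · rw [hspan, Set.range_eq_empty, Submodule.span_empty]
  | succ n ih =>
    intro L θ₀ hθ₀ hL hθ₀L hrank
    haveI := finiteDimensional_span_of_fg' (K := K) hL
    have hL0 : L ≠ ⊥ := by
      rintro rfl
      rw [Submodule.bot_coe, Submodule.span_singleton_eq_bot.2 rfl] at hrank
      · simp at hrank
    -- the multiplier order `O = ℤ + ℤθ`, a good vector `m`, and the splitting `L = I_m m ⊕ L₂`
    obtain ⟨O, hO⟩ := exists_multiplier' (K := K) L
    obtain ⟨θ, hθ, hOeq, -⟩ := multiplier_eq_span_one_pair h2 hL hL0 hθ₀ hθ₀L hO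
    obtain ⟨m, hmL, hm0, hgood⟩ := exists_good_vector h2 hL hL0 hO hθ hOeq
    obtain ⟨α₀, β₀, L₂, hli₀, hJ, hL₂L, hθL₂, hmL₂, hdec⟩ :=
      exists_splitting h2 hL hO hθ hOeq hmL hm0 hgood
    have hL₂fg : L₂.FG := fg_of_le' hL₂L hL
    haveI := finiteDimensional_span_of_fg' (K := K) hL₂fg
    -- `KL = Km ⊕ KL₂`, so `dim KL₂ = n`
    have hsup : Submodule.span K (L : Set V) = (K ∙ m) ⊔ Submodule.span K (L₂ : Set V) := by
      apply le_antisymm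
      · rw [Submodule.span_le]
        intro v hv
        obtain ⟨x, -, w, hw, rfl⟩ := (hdec v).1 hv
        exact Submodule.add_mem_sup (Submodule.smul_mem _ x (Submodule.mem_span_singleton_self m))
          (Submodule.subset_span hw)
      · exact sup_le (by rw [Submodule.span_singleton_le_iff_mem]; exact Submodule.subset_span hmL)
          (Submodule.span_mono hL₂L)
    have hinf : (K ∙ m) ⊓ Submodule.span K (L₂ : Set V) = ⊥ :=
      disjoint_iff.1 ((Submodule.disjoint_span_singleton' hm0).2 hmL₂).symm
    have hrank₂ : finrank K (Submodule.span K (L₂ : Set V)) = n := by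
      have h := Submodule.finrank_sup_add_finrank_inf_eq (K ∙ m) (Submodule.span K (L₂ : Set V))
      rw [← hsup, hinf, finrank_bot, add_zero, hrank, finrank_span_singleton hm0] at h
      omega
    -- the orders: `R(I_m) = O ⊆ R(L₂)`
    set J : Submodule ℤ K := Submodule.span ℤ ({α₀, β₀} : Set K) with hJdef
    have hOJ : ∀ x ∈ O, x ∈ J / J := by
      intro x hx
      rw [Submodule.mem_div_iff_forall_mul_mem]
      intro z hz
      rw [hJ] at hz ⊢
      rw [mul_smul]
      exact (hO x).1 hx _ hz
    have hJO : ∀ x ∈ J / J, x ∈ O := by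
      intro x hx
      rw [Submodule.mem_div_iff_forall_mul_mem] at hx
      refine hgood x fun z hz => ?_
      rw [← hJ] at hz ⊢
      exact hx z hz
    have hOL₂ : ∀ x ∈ O, ∀ v ∈ L₂, x • v ∈ L₂ := by
      intro x hx v hv
      rw [hOeq] at hx
      exact smul_mem_of_mem_span_one_pair' hθL₂ hx hv
    -- induction hypothesis for `L₂` (stable under the irrational `θ`)
    obtain ⟨y, α, β, hliy, hyL₂, hαβ, hmem, hspan, hchain, hfirst⟩ := ih L₂ θ hθ hL₂fg hθL₂ hrank₂
    refine ⟨Fin.cons m y, Fin.cons α₀ α, Fin.cons β₀ β, ?_, ?_, ?_, fun v => ?_, ?_, ?_, ?_⟩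
    · rw [linearIndependent_finCons]
      refine ⟨hliy, ?_⟩
      rw [hspan]; exact hmL₂
    · intro i
      refine Fin.cases hmL (fun j => ?_) i
      rw [Fin.cons_succ]; exact hL₂L (hyL₂ j)
    · intro i
      refine Fin.cases ?_ (fun j => ?_) i
      · simpa using hli₀
      · simpa using hαβ j
    · rw [hdec]
      constructor
      · rintro ⟨x, hx, w, hw, rfl⟩
        obtain ⟨c, hc, rfl⟩ := (hmem w).1 hw
        refine ⟨Fin.cons x c, fun i => Fin.cases (by simpa using hx) (fun j => by simpa using hc j) i,
          ?_⟩
        rw [Fin.sum_univ_succ]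
        simp
      · rintro ⟨c, hc, rfl⟩
        refine ⟨c 0, by simpa using hc 0, ∑ j : Fin n, c j.succ • y j,
          (hmem _).2 ⟨fun j => c j.succ, fun j => by simpa using hc j.succ, rfl⟩, ?_⟩
        rw [Fin.sum_univ_succ]
        simp
    · rw [Fin.range_cons, Submodule.span_insert, hspan, hsup]
    · -- the chain
      intro i j hij
      refine Fin.cases ?_ (fun i' => ?_) i hij <;> refine Fin.cases ?_ (fun j' => ?_) j
      · intro; exact le_rfl
      · intro _ x hx
        simp only [Fin.cons_zero, Fin.cons_succ] at hx ⊢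
        exact hfirst j' x (hOL₂ x (hJO x hx))
      · intro h; exact absurd h (by simp)
      · intro h
        simp only [Fin.cons_succ]
        exact hchain i' j' (Fin.succ_le_succ_iff.1 h)
    · -- `R(L) ⊆ R(Iᵢ)` for every `i`
      intro i x hx
      have hxO : x ∈ O := (hO x).2 hx
      refine Fin.cases ?_ (fun j => ?_) i
      · simpa using hOJ x hxO
      · simpa using hfirst j x (hOL₂ x hxO)

end Chain

/-! ## §2. The determinant lattice of a decomposition: `D = I₁⋯Iₙ`, and `D ↦ det(A)·D` under a change
of decomposition (JKPRST Thm. 3.2 (2): the product `I₁⋯Iₙ` up to `K^×` is an invariant) -/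

section Det

variable {K : Type*} [Field K]
variable {n : ℕ}

/-- Products of elements of lattices lie in the product lattice. [folklore] -/
private theorem prod_mem_prod' {ι : Type*} [DecidableEq ι] {s : Finset ι} {M : ι → Submodule ℤ K}
    {f : ι → K} (h : ∀ i ∈ s, f i ∈ M i) : (∏ i ∈ s, f i) ∈ ∏ i ∈ s, M i := by
  induction s using Finset.induction_on with
  | empty =>
    rw [Finset.prod_empty, Finset.prod_empty]
    exact Submodule.mem_one.2 ⟨1, map_one _⟩
  | insert a s ha ih =>
    rw [Finset.prod_insert ha, Finset.prod_insert ha]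
    exact Submodule.mul_mem_mul (h a (Finset.mem_insert_self a s))
      (ih fun i hi => h i (Finset.mem_insert_of_mem hi))

/-- **Leibniz**: a determinant whose `i`-th ROW has all its entries in the lattice `Iᵢ` lies in the
product lattice `I₁⋯Iₙ` («if `M = I₁ ⊕ ⋯ ⊕ I_r` … `det M ≅ I₁ ⊗ ⋯ ⊗ I_r ≅ I₁⋯I_r` (the product
ideal in `R`)», here for lattices of a field).
[cite: JKPRST2018IsogenousPowerElliptic, §3.1 (determinant of a module), p. 6] -/
theorem det_mem_prod_of_forall_mem {I : Fin n → Submodule ℤ K} {C : Matrix (Fin n) (Fin n) K}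
    (hC : ∀ i j, C i j ∈ I i) : C.det ∈ ∏ i, I i := by
  classical
  rw [Matrix.det_apply]
  refine Submodule.sum_mem _ fun σ _ => ?_
  have hprod : ∏ i, C (σ i) i ∈ ∏ i, I i := by
    have h : ∏ i, C (σ i) i ∈ ∏ i, I (σ i) :=
      prod_mem_prod' (M := fun i => I (σ i)) (f := fun i => C (σ i) i) fun i _ => hC (σ i) i
    have hre : (∏ i, I (σ i)) = ∏ i, I i := Equiv.prod_comp σ I
    rwa [hre] at h
  rw [Units.smul_def]
  exact Submodule.smul_mem _ _ hprod

/-- **The product lattice is generated by determinants**: `I₁⋯Iₙ` is spanned by the products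
`a₁⋯aₙ = det(diag(a₁, …, aₙ))`, `aᵢ ∈ Iᵢ`.
[cite: JKPRST2018IsogenousPowerElliptic, §3.1 (determinant of a module), p. 6] -/
theorem prod_le_span_det (I : Fin n → Submodule ℤ K) :
    (∏ i, I i) ≤ Submodule.span ℤ
      {d : K | ∃ C : Matrix (Fin n) (Fin n) K, (∀ i j, C i j ∈ I i) ∧ C.det = d} := by
  classical
  have hspan : (∏ i, I i) = Submodule.span ℤ (∏ i, (I i : Set K)) := by
    rw [← Submodule.prod_span]
    simp only [Submodule.span_eq]
  rw [hspan, Submodule.span_le]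
  intro d hd
  rw [Set.mem_finsetProd] at hd
  obtain ⟨a, ha, rfl⟩ := hd
  refine Submodule.subset_span ⟨Matrix.diagonal a, fun i j => ?_, Matrix.det_diagonal⟩
  by_cases h : i = j
  · subst h; rw [Matrix.diagonal_apply_eq]; exact ha (Finset.mem_univ i)
  · rw [Matrix.diagonal_apply_ne _ h]; exact Submodule.zero_mem _

/-- **The determinant lattice of a decomposition is the product of the coefficient lattices**:
`ℤ·{det C : the j-th column of C is the coefficient vector of a lattice vector} = I₁⋯Iₙ`.
[cite: JKPRST2018IsogenousPowerElliptic, §3.2 Thm. 3.2 (2) («their product `I₁⋯Iₙ`»), p. 6] -/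
theorem span_det_eq_prod (I : Fin n → Submodule ℤ K) :
    Submodule.span ℤ {d : K | ∃ C : Matrix (Fin n) (Fin n) K, (∀ i j, C i j ∈ I i) ∧ C.det = d} =
      ∏ i, I i := by
  refine le_antisymm ?_ (prod_le_span_det I)
  rw [Submodule.span_le]
  rintro d ⟨C, hC, rfl⟩
  exact det_mem_prod_of_forall_mem hC

/-- **Change of decomposition multiplies the product by a determinant.** If the coefficient vectors
with entries in the `Jᵢ` are exactly the `A`-images of those with entries in the `Iᵢ` (this is what a
`K`-linear isomorphism between two decomposed lattices does to coordinates), then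
`J₁⋯Jₙ = det(A)·I₁⋯Iₙ`: «The `Iᵢ` are not unique, but their product `I₁⋯Iₙ` is an invertible
`Rₙ`-ideal whose class `[M] ∈ Pic Rₙ` depends only on `M`.»
[cite: JKPRST2018IsogenousPowerElliptic, §3.2 Thm. 3.2 (2), p. 6] -/
theorem prod_eq_det_smul_prod {I J : Fin n → Submodule ℤ K} (A : Matrix (Fin n) (Fin n) K)
    (hIJ : ∀ c' : Fin n → K, (∀ i, c' i ∈ J i) ↔
      ∃ c : Fin n → K, (∀ i, c i ∈ I i) ∧ c' = A.mulVec c) :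
    (∏ i, J i) = A.det • ∏ i, I i := by
  classical
  rw [← span_det_eq_prod J, ← span_det_eq_prod I, Submodule.smul_span]
  congr 1
  ext d
  simp only [Set.mem_setOf_eq, Set.mem_smul_set, smul_eq_mul]
  constructor
  · rintro ⟨C', hC', rfl⟩
    -- every column of `C'` is `A *ᵥ (column of some C)`
    choose c hc hc' using fun j => (hIJ fun i => C' i j).1 fun i => hC' i j
    refine ⟨(Matrix.of fun i j => c j i).det, ⟨Matrix.of fun i j => c j i, fun i j => hc j i, rfl⟩, ?_⟩
    rw [← Matrix.det_mul]
    congr 1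
    ext i j
    have hij : C' i j = A.mulVec (c j) i := congrFun (hc' j) i
    rw [Matrix.mul_apply, hij, Matrix.mulVec, dotProduct]
    simp only [Matrix.of_apply]
  · rintro ⟨d, ⟨C, hC, rfl⟩, rfl⟩
    refine ⟨A * C, fun i j => ?_, Matrix.det_mul _ _⟩
    have h : (fun i => (A * C) i j) = A.mulVec fun i => C i j := by
      ext i
      rw [Matrix.mul_apply, Matrix.mulVec, dotProduct]
    have hj : ∀ i, (fun i => (A * C) i j) i ∈ J i :=
      (hIJ _).2 ⟨fun i => C i j, fun i => hC i j, h⟩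
    exact hj i

/-- A non-zero lattice vector in each `Iᵢ` gives a non-zero element of the product. [folklore] -/
private theorem prod_ne_bot_of_forall_ne_bot {I : Fin n → Submodule ℤ K} (hI : ∀ i, I i ≠ ⊥) :
    (∏ i, I i) ≠ ⊥ := by
  classical
  choose a ha ha0 using fun i => Submodule.exists_mem_ne_zero_of_ne_bot (hI i)
  intro h
  have hmem : ∏ i, a i ∈ ∏ i, I i := prod_mem_prod' (M := I) (f := a) fun i _ => ha i
  rw [h, Submodule.mem_bot] at hmem
  exact Finset.prod_ne_zero_iff.2 (fun i _ => ha0 i) hmem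

/-- If `J₁⋯Jₙ = det(A)·I₁⋯Iₙ` with all `Jᵢ ≠ 0`, then `det A ≠ 0`. [folklore] -/
private theorem det_ne_zero_of_prod_eq_det_smul_prod {I J : Fin n → Submodule ℤ K} {A : Matrix (Fin n) (Fin n) K}
    (hJ : ∀ i, J i ≠ ⊥) (h : (∏ i, J i) = A.det • ∏ i, I i) : A.det ≠ 0 := by
  intro h0
  apply prod_ne_bot_of_forall_ne_bot hJ
  rw [h, h0, eq_bot_iff]
  intro x hx
  obtain ⟨y, -, rfl⟩ := (Submodule.mem_smul_pointwise_iff_exists x (0 : K) _).1 hx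
  rw [zero_smul]
  exact Submodule.zero_mem _

end Det

/-! ## §3. The product `I₁⋯Iₙ` of a chain is an invertible `Rₙ`-ideal and `R(I₁⋯Iₙ) = Rₙ` -/

section Orders

variable {K : Type*} [Field K]
variable {n : ℕ}

/-- For orders `𝒪 ⊆ 𝒪′` (lattices containing `1`, closed under multiplication): `𝒪𝒪′ = 𝒪′`.
[folklore] -/
private theorem mul_eq_right_of_le {O O' : Submodule ℤ K} (h1 : (1 : K) ∈ O) (hmul : O' * O' ≤ O')
    (hle : O ≤ O') : O * O' = O' := by
  refine le_antisymm ((mul_le_mul' hle le_rfl).trans hmul) fun x hx => ?_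
  simpa only [one_mul] using Submodule.mul_mem_mul h1 hx

/-- **The product of a chain of orders is its largest member**: `R₁R₂⋯Rₙ = Rₙ` for
`R₁ ⊆ R₂ ⊆ ⋯ ⊆ Rₙ`. [folklore] -/
private theorem prod_eq_last_of_chain : ∀ {n : ℕ} (O : Fin (n + 1) → Submodule ℤ K),
    (∀ i, (1 : K) ∈ O i) → (∀ i, O i * O i ≤ O i) → (∀ i j, i ≤ j → O i ≤ O j) →
      ∏ i, O i = O (Fin.last n)
  | 0, O, _, _, _ => by simp
  | n + 1, O, h1, hmul, hchain => by
    rw [Fin.prod_univ_castSucc, prod_eq_last_of_chain (fun i => O (Fin.castSucc i))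
      (fun i => h1 _) (fun i => hmul _) (fun i j hij => hchain _ _ (by simpa using hij))]
    exact mul_eq_right_of_le (h1 _) (hmul _) (hchain _ _ (Fin.le_last _))

/-- **Two nested orders**: if `P𝔫 = (P : P)`, `I𝔫′ = (I : I)` and `(P : P) ⊆ (I : I)`, then
`(PI)(𝔫𝔫′) = (I : I)` and `(PI : PI) = (I : I)` — the product of invertible lattices over NESTED
orders is invertible over the larger order (Cox's «`I(𝒪)` is a group» is the case of equal orders).
[cite: JKPRST2018IsogenousPowerElliptic, §3.2 Thm. 3.2 (2) («`I₁⋯Iₙ` is an invertible `Rₙ`-ideal»), p. 6] -/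
theorem mul_mul_mul_eq_of_div_le {P N I N' : Submodule ℤ K} (hP : P * N = P / P)
    (hI : I * N' = I / I) (hle : P / P ≤ I / I) :
    (P * I) * (N * N') = I / I ∧ (P * I) / (P * I) = I / I := by
  have hprod : (P * I) * (N * N') = I / I := by
    rw [mul_mul_mul_comm, hP, hI]
    exact mul_eq_right_of_le (QuadraticLattice.one_mem_div_self _)
      (QuadraticLattice.div_self_mul_div_self_le _) hle
  refine ⟨hprod, QuadraticLattice.div_self_eq_of_mul_eq (QuadraticLattice.one_mem_div_self _) ?_ hprod⟩
  rw [mul_left_comm]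
  exact mul_le_mul' le_rfl (Submodule.le_div_iff_mul_le.1 le_rfl)

/-- **JKPRST Thm. 3.2 (2), first half: `I₁⋯Iₙ` is an invertible `Rₙ`-ideal and its order is `Rₙ`.**
For lattices `I₀, …, Iₙ` of a field, each invertible for its own order (`Iᵢ𝔫ᵢ = (Iᵢ : Iᵢ)` — in a
quadratic field this is automatic, Cox Prop. 7.4 = `QuadraticLattice.exists_mul_eq_div_self`) and
with orders forming a chain `(I₀ : I₀) ⊆ ⋯ ⊆ (Iₙ : Iₙ)`: `(I₀⋯Iₙ)(𝔫₀⋯𝔫ₙ) = (Iₙ : Iₙ)` and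
`(I₀⋯Iₙ : I₀⋯Iₙ) = (Iₙ : Iₙ)`. [cite: JKPRST2018IsogenousPowerElliptic, §3.2 Thm. 3.2 (2), p. 6] -/
theorem prod_mul_prod_eq_last_and_div_self_prod {I N : Fin (n + 1) → Submodule ℤ K}
    (hinv : ∀ i, I i * N i = I i / I i)
    (hchain : ∀ i j, i ≤ j → I i / I i ≤ I j / I j) :
    (∏ i, I i) * (∏ i, N i) = I (Fin.last n) / I (Fin.last n) ∧
      (∏ i, I i) / (∏ i, I i) = I (Fin.last n) / I (Fin.last n) := by
  have hprod : (∏ i, I i) * (∏ i, N i) = I (Fin.last n) / I (Fin.last n) := by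
    rw [← Finset.prod_mul_distrib]
    simp_rw [hinv]
    exact prod_eq_last_of_chain (fun i => I i / I i) (fun i => QuadraticLattice.one_mem_div_self _)
      (fun i => QuadraticLattice.div_self_mul_div_self_le _) hchain
  refine ⟨hprod, QuadraticLattice.div_self_eq_of_mul_eq (QuadraticLattice.one_mem_div_self _) ?_ hprod⟩
  -- `Rₙ · (I₀⋯Iₙ) ⊆ I₀⋯Iₙ` because `Rₙ Iₙ ⊆ Iₙ`
  rw [Fin.prod_univ_castSucc, mul_left_comm]
  exact mul_le_mul' le_rfl (Submodule.le_div_iff_mul_le.1 le_rfl)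

end Orders

/-! ## §4. Lattices in a `K`-vector space: coordinates under a `K`-linear isomorphism, and the
invariance of `R(L)`, of `Rₙ = R(I₁⋯Iₙ)` and of the class of `I₁⋯Iₙ` -/

section Transport

variable {K : Type*} [Field K]
variable {V : Type*} [AddCommGroup V] [Module K V]
variable {V' : Type*} [AddCommGroup V'] [Module K V']
variable {n : ℕ}

/-- Coordinates with respect to a `K`-independent family are unique. [folklore] -/
private theorem eq_of_sum_smul_eq_sum_smul {y : Fin n → V} (hli : LinearIndependent K y) {a b : Fin n → K}
    (h : ∑ i, a i • y i = ∑ i, b i • y i) : a = b := by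
  funext i
  have hz := Fintype.linearIndependent_iff.1 hli (fun i => a i - b i) (by
    simp_rw [sub_smul, Finset.sum_sub_distrib, h, sub_self])
  exact sub_eq_zero.1 (hz i)

/-- A `K`-linear map in coordinates: `f(Σⱼ cⱼ yⱼ) = Σᵢ (A c)ᵢ y′ᵢ` when `f(yⱼ) = Σᵢ Aᵢⱼ y′ᵢ`.
[folklore] -/
private theorem map_sum_smul_eq_sum_mulVec_smul {y : Fin n → V} {y' : Fin n → V'} (f : V →ₗ[K] V')
    (A : Matrix (Fin n) (Fin n) K) (hA : ∀ j, f (y j) = ∑ i, A i j • y' i) (c : Fin n → K) :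
    f (∑ j, c j • y j) = ∑ i, (A.mulVec c) i • y' i := by
  rw [map_sum]
  simp_rw [map_smul, hA, Finset.smul_sum, smul_smul]
  rw [Finset.sum_comm]
  refine Finset.sum_congr rfl fun i _ => ?_
  rw [Matrix.mulVec, dotProduct, Finset.sum_smul]
  refine Finset.sum_congr rfl fun j _ => ?_
  rw [mul_comm]

/-- **What an isomorphism does to coordinates.** If `f : V → V′` is `K`-linear with `f(L) = L′`,
`L = ⊕ Iⱼyⱼ` (`yⱼ ∈ L`), `L′ = ⊕ Jᵢy′ᵢ` (`y′` independent), and `A` is the matrix of `f` on the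
`y`'s (`f(yⱼ) = Σᵢ Aᵢⱼ y′ᵢ`), then the coefficient vectors of `L′` are exactly the `A`-images of those
of `L` (the mechanism behind «depends only on `M`»).
[cite: JKPRST2018IsogenousPowerElliptic, §3.2 Thm. 3.2 (2), p. 6] -/
theorem coeff_iff_of_map_eq {L : Submodule ℤ V} {L' : Submodule ℤ V'} {y : Fin n → V}
    {y' : Fin n → V'} {I J : Fin n → Submodule ℤ K} (hli' : LinearIndependent K y')
    (hmem : ∀ v : V, v ∈ L ↔ ∃ c : Fin n → K, (∀ i, c i ∈ I i) ∧ v = ∑ i, c i • y i)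
    (hmem' : ∀ v : V', v ∈ L' ↔ ∃ c : Fin n → K, (∀ i, c i ∈ J i) ∧ v = ∑ i, c i • y' i)
    (f : V →ₗ[K] V') (hf : L.map (f.restrictScalars ℤ) = L')
    (A : Matrix (Fin n) (Fin n) K) (hA : ∀ j, f (y j) = ∑ i, A i j • y' i) (c' : Fin n → K) :
    (∀ i, c' i ∈ J i) ↔ ∃ c : Fin n → K, (∀ i, c i ∈ I i) ∧ c' = A.mulVec c := by
  constructor
  · intro hc'
    have hv' : ∑ i, c' i • y' i ∈ L' := (hmem' _).2 ⟨c', hc', rfl⟩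
    rw [← hf, Submodule.mem_map] at hv'
    obtain ⟨v, hv, hfv⟩ := hv'
    obtain ⟨c, hc, rfl⟩ := (hmem v).1 hv
    refine ⟨c, hc, eq_of_sum_smul_eq_sum_smul hli' ?_⟩
    rw [← map_sum_smul_eq_sum_mulVec_smul f A hA, ← hfv, LinearMap.restrictScalars_apply]
  · rintro ⟨c, hc, rfl⟩
    have hv : ∑ i, c i • y i ∈ L := (hmem _).2 ⟨c, hc, rfl⟩
    have hfv : f (∑ i, c i • y i) ∈ L' := by
      rw [← hf]
      exact ⟨_, hv, rfl⟩
    rw [map_sum_smul_eq_sum_mulVec_smul f A hA] at hfv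
    obtain ⟨c'', hc'', he⟩ := (hmem' _).1 hfv
    rw [eq_of_sum_smul_eq_sum_smul hli' he]
    exact hc''

/-- **JKPRST Thm. 3.2 (2) — the product of the coefficient lattices transforms by a determinant.**
For decomposed lattices `L = ⊕ Iⱼyⱼ ⊆ V` (`yⱼ ∈ L`) and `L′ = ⊕ Jᵢy′ᵢ ⊆ V′` and a `K`-linear `f`
with `f(L) = L′` (e.g. the rational extension of any module isomorphism `L ≅ L′`):
`J₁⋯Jₙ = det(A)·I₁⋯Iₙ` for the matrix `A` of `f`.  With all `Jᵢ ≠ 0`, `det A ≠ 0`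
(`det_ne_zero_of_prod_eq_det_smul_prod`), so the products agree up to `K^×`: «their product
`I₁⋯Iₙ` is an invertible `Rₙ`-ideal whose class `[M] ∈ Pic Rₙ` depends only on `M`».
[cite: JKPRST2018IsogenousPowerElliptic, §3.2 Thm. 3.2 (2), p. 6] -/
theorem exists_prod_eq_det_smul_prod_of_map_eq {L : Submodule ℤ V} {L' : Submodule ℤ V'}
    {y : Fin n → V} {y' : Fin n → V'} {I J : Fin n → Submodule ℤ K}
    (hli' : LinearIndependent K y') (hy : ∀ j, y j ∈ L)
    (hmem : ∀ v : V, v ∈ L ↔ ∃ c : Fin n → K, (∀ i, c i ∈ I i) ∧ v = ∑ i, c i • y i)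
    (hmem' : ∀ v : V', v ∈ L' ↔ ∃ c : Fin n → K, (∀ i, c i ∈ J i) ∧ v = ∑ i, c i • y' i)
    (f : V →ₗ[K] V') (hf : L.map (f.restrictScalars ℤ) = L') :
    ∃ A : Matrix (Fin n) (Fin n) K, (∀ j, f (y j) = ∑ i, A i j • y' i) ∧
      (∏ i, J i) = A.det • ∏ i, I i := by
  -- the matrix of `f`: `f(yⱼ) ∈ L′` has coefficients in the `Jᵢ`
  have hfy : ∀ j, f (y j) ∈ L' := fun j => by
    rw [← hf]
    exact ⟨_, hy j, rfl⟩
  choose a _ ha using fun j => (hmem' _).1 (hfy j)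
  refine ⟨Matrix.of fun i j => a j i, fun j => by simpa only [Matrix.of_apply] using ha j, ?_⟩
  exact prod_eq_det_smul_prod _ (coeff_iff_of_map_eq hli' hmem hmem' f hf _ fun j => by
    simpa only [Matrix.of_apply] using ha j)

/-- **The multiplier order `R(L)` is an isomorphism invariant**: for an injective `K`-linear `f`,
`x·f(L) ⊆ f(L) ⟺ xL ⊆ L` (so the smallest order `R₁ = R(M)` of the «unique chain» is determined by
`M`). [cite: JKPRST2018IsogenousPowerElliptic, §3.2 Thm. 3.2 (1), p. 6] -/
theorem forall_smul_mem_map_iff (f : V →ₗ[K] V') (hf : Function.Injective f) (L : Submodule ℤ V)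
    (x : K) :
    (∀ v' ∈ L.map (f.restrictScalars ℤ), x • v' ∈ L.map (f.restrictScalars ℤ)) ↔
      ∀ v ∈ L, x • v ∈ L := by
  constructor
  · intro h v hv
    obtain ⟨w, hw, hfw⟩ := h (f v) ⟨v, hv, rfl⟩
    rw [LinearMap.restrictScalars_apply, ← map_smul] at hfw
    rwa [← hf hfw]
  · rintro h _ ⟨v, hv, rfl⟩
    refine ⟨x • v, h v hv, ?_⟩
    rw [LinearMap.restrictScalars_apply, LinearMap.restrictScalars_apply, map_smul]

end Transport

/-! ## §5. Assembly for quadratic orders: the normal form and the invariants (JKPRST Thm. 3.2 (1)–(2)) -/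

section Assembly

variable {K : Type*} [Field K] [CharZero K]
variable {V : Type*} [AddCommGroup V] [Module K V]
variable {V' : Type*} [AddCommGroup V'] [Module K V']

/-- **BOREVICH–FADDEEV NORMAL FORM, EXISTENCE (JKPRST 2018, Thm. 3.2 (1) with the chain condition).**
Let `K` be a quadratic field, `V` a `K`-vector space and `L ⊆ V` a finitely generated `ℤ`-submodule
stable under some irrational `θ₀ ∈ K` (a lattice over the order `ℤ[θ₀]`, hence over its multiplier
order `R(L) = {x : xL ⊆ L}`).  Then `L = I₁y₁ ⊕ ⋯ ⊕ Iₙyₙ` with `y` a `K`-basis of `KL` inside `L`,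
`Iᵢ = ℤαᵢ + ℤβᵢ` rank-two lattices of `K` (each invertible for its own order `Rᵢ = (Iᵢ : Iᵢ)`,
Cox Prop. 7.4), **whose orders form a chain `R₁ ⊆ R₂ ⊆ ⋯ ⊆ Rₙ` with `R₁ = R(L)`** (last two
clauses: the chain, and `R(L) ⊆ Rᵢ` for all `i`; with `forall_smul_mem_iff_forall_mem_div`,
`R(L) = ⋂ Rᵢ = R₁`).  «There exists a unique chain of orders `R₁ ⊆ ⋯ ⊆ Rₙ` between `R` and `K` and
invertible ideals `I₁, …, Iₙ` of `R₁, …, Rₙ`, respectively, such that `M ≅ I₁ ⊕ ⋯ ⊕ Iₙ` as an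
`R`-module.» (Uniqueness of the chain: see the sequel file.)
[cite: JKPRST2018IsogenousPowerElliptic, §3.2 Thm. 3.2 (1), p. 6] -/
theorem exists_chain_decomposition (h2 : finrank ℚ K = 2) {L : Submodule ℤ V} (hL : L.FG)
    {θ₀ : K} (hθ₀ : ∀ q : ℚ, (q : K) ≠ θ₀) (hθ₀L : ∀ v ∈ L, θ₀ • v ∈ L) :
    ∃ (n : ℕ) (y : Fin n → V) (α β : Fin n → K),
      n = finrank K (Submodule.span K (L : Set V)) ∧
      LinearIndependent K y ∧ (∀ i, y i ∈ L) ∧ (∀ i, LinearIndependent ℚ ![α i, β i]) ∧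
      (∀ v : V, v ∈ L ↔ ∃ c : Fin n → K,
        (∀ i, c i ∈ Submodule.span ℤ ({α i, β i} : Set K)) ∧ v = ∑ i, c i • y i) ∧
      Submodule.span K (Set.range y) = Submodule.span K (L : Set V) ∧
      (∀ i j : Fin n, i ≤ j →
        Submodule.span ℤ ({α i, β i} : Set K) / Submodule.span ℤ ({α i, β i} : Set K) ≤
          Submodule.span ℤ ({α j, β j} : Set K) / Submodule.span ℤ ({α j, β j} : Set K)) ∧
      (∀ (i : Fin n) (x : K), (∀ v ∈ L, x • v ∈ L) →
        x ∈ Submodule.span ℤ ({α i, β i} : Set K) / Submodule.span ℤ ({α i, β i} : Set K)) := by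
  obtain ⟨y, α, β, h⟩ := exists_chain_decomposition_aux h2 _ L θ₀ hθ₀ hL hθ₀L rfl
  exact ⟨_, y, α, β, rfl, h⟩

omit [CharZero K] in
/-- **`R₁ = R(L)`**: for a chain decomposition the multiplier order of `L` is the SMALLEST order of
the chain. [cite: JKPRST2018IsogenousPowerElliptic, §3.2 Thm. 3.2 (1), p. 6] -/
theorem forall_smul_mem_iff_mem_div_first {n : ℕ} {L : Submodule ℤ V} {y : Fin (n + 1) → V}
    {I : Fin (n + 1) → Submodule ℤ K} (hli : LinearIndependent K y)
    (hmem : ∀ v : V, v ∈ L ↔ ∃ c : Fin (n + 1) → K, (∀ i, c i ∈ I i) ∧ v = ∑ i, c i • y i)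
    (hchain : ∀ i j, i ≤ j → I i / I i ≤ I j / I j) (x : K) :
    (∀ v ∈ L, x • v ∈ L) ↔ x ∈ I 0 / I 0 := by
  rw [forall_smul_mem_iff_forall_mem_div hli hmem]
  exact ⟨fun h => h 0, fun h i => hchain 0 i (Fin.zero_le i) h⟩

/-- **JKPRST Thm. 3.2 (2) for the normal form: `I₁⋯Iₙ` is an invertible `Rₙ`-ideal, `Rₙ` the LARGEST
order of the chain, and `(I₁⋯Iₙ : I₁⋯Iₙ) = Rₙ`** (quadratic field: every `Iᵢ = ℤαᵢ + ℤβᵢ` is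
invertible for its own order by Cox Prop. 7.4).
[cite: JKPRST2018IsogenousPowerElliptic, §3.2 Thm. 3.2 (2), p. 6] -/
theorem exists_prod_mul_eq_last (h2 : finrank ℚ K = 2) {n : ℕ} {α β : Fin (n + 1) → K}
    (hαβ : ∀ i, LinearIndependent ℚ ![α i, β i])
    (hchain : ∀ i j, i ≤ j →
      Submodule.span ℤ ({α i, β i} : Set K) / Submodule.span ℤ ({α i, β i} : Set K) ≤
        Submodule.span ℤ ({α j, β j} : Set K) / Submodule.span ℤ ({α j, β j} : Set K)) :
    (∃ N : Submodule ℤ K, (∏ i, Submodule.span ℤ ({α i, β i} : Set K)) * N =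
        Submodule.span ℤ ({α (Fin.last n), β (Fin.last n)} : Set K) /
          Submodule.span ℤ ({α (Fin.last n), β (Fin.last n)} : Set K)) ∧
      (∏ i, Submodule.span ℤ ({α i, β i} : Set K)) / (∏ i, Submodule.span ℤ ({α i, β i} : Set K)) =
        Submodule.span ℤ ({α (Fin.last n), β (Fin.last n)} : Set K) /
          Submodule.span ℤ ({α (Fin.last n), β (Fin.last n)} : Set K) := by
  choose N hN using fun i => QuadraticLattice.exists_mul_eq_div_self h2 (hαβ i)
  obtain ⟨hprod, hdiv⟩ := prod_mul_prod_eq_last_and_div_self_prod (I := fun i =>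
    Submodule.span ℤ ({α i, β i} : Set K)) (N := N) hN hchain
  exact ⟨⟨_, hprod⟩, hdiv⟩

omit [CharZero K] in
/-- **JKPRST Thm. 3.2 (2) — invariance.** Two decomposed lattices `L = ⊕ Iⱼyⱼ ⊆ V` and
`L′ = ⊕ Jᵢy′ᵢ ⊆ V′` (all `Jᵢ ≠ 0`) identified by a `K`-linear `f` with `f(L) = L′` have products in
the same class: `J₁⋯Jₙ = d·I₁⋯Iₙ` with `d ∈ K^×`; consequently the orders of the products coincide,
`(J₁⋯Jₙ : J₁⋯Jₙ) = (I₁⋯Iₙ : I₁⋯Iₙ)` — for chain decompositions this is `Rₙ(L′) = Rₙ(L)` — and so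
do the classes `[I₁⋯Iₙ] = [J₁⋯Jₙ] ∈ Pic Rₙ`. [cite: JKPRST2018IsogenousPowerElliptic, §3.2 Thm. 3.2 (2), p. 6] -/
theorem exists_prod_eq_smul_prod_of_map_eq {n : ℕ} {L : Submodule ℤ V} {L' : Submodule ℤ V'}
    {y : Fin n → V} {y' : Fin n → V'} {I J : Fin n → Submodule ℤ K}
    (hli' : LinearIndependent K y') (hy : ∀ j, y j ∈ L) (hJ : ∀ i, J i ≠ ⊥)
    (hmem : ∀ v : V, v ∈ L ↔ ∃ c : Fin n → K, (∀ i, c i ∈ I i) ∧ v = ∑ i, c i • y i)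
    (hmem' : ∀ v : V', v ∈ L' ↔ ∃ c : Fin n → K, (∀ i, c i ∈ J i) ∧ v = ∑ i, c i • y' i)
    (f : V →ₗ[K] V') (hf : L.map (f.restrictScalars ℤ) = L') :
    (∃ d : K, d ≠ 0 ∧ (∏ i, J i) = d • ∏ i, I i) ∧
      (∏ i, J i) / (∏ i, J i) = (∏ i, I i) / (∏ i, I i) := by
  obtain ⟨A, -, hA⟩ := exists_prod_eq_det_smul_prod_of_map_eq hli' hy hmem hmem' f hf
  have hdet : A.det ≠ 0 := det_ne_zero_of_prod_eq_det_smul_prod hJ hA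
  exact ⟨⟨A.det, hdet, hA⟩, by rw [hA, QuadraticLattice.smul_div_smul hdet]⟩

omit [CharZero K] in
/-- **JKPRST Thm. 3.2 — the smallest order `R₁ = R(L)` is an isomorphism invariant**: for chain
decompositions of `L ⊆ V` and of `L′ = f(L) ⊆ V′` (`f` injective `K`-linear), `(I₁ : I₁) = (J₁ : J₁)`.
[cite: JKPRST2018IsogenousPowerElliptic, §3.2 Thm. 3.2 (1)–(3), p. 6] -/
theorem div_first_eq_of_map_eq {n n' : ℕ} {L : Submodule ℤ V} {L' : Submodule ℤ V'}
    {y : Fin (n + 1) → V} {y' : Fin (n' + 1) → V'} {I : Fin (n + 1) → Submodule ℤ K}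
    {J : Fin (n' + 1) → Submodule ℤ K} (hli : LinearIndependent K y) (hli' : LinearIndependent K y')
    (hmem : ∀ v : V, v ∈ L ↔ ∃ c : Fin (n + 1) → K, (∀ i, c i ∈ I i) ∧ v = ∑ i, c i • y i)
    (hmem' : ∀ v : V', v ∈ L' ↔ ∃ c : Fin (n' + 1) → K, (∀ i, c i ∈ J i) ∧ v = ∑ i, c i • y' i)
    (hchain : ∀ i j, i ≤ j → I i / I i ≤ I j / I j) (hchain' : ∀ i j, i ≤ j → J i / J i ≤ J j / J j)
    (f : V →ₗ[K] V') (hfi : Function.Injective f) (hf : L.map (f.restrictScalars ℤ) = L') :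
    I 0 / I 0 = J 0 / J 0 := by
  ext x
  rw [← forall_smul_mem_iff_mem_div_first hli hmem hchain,
    ← forall_smul_mem_iff_mem_div_first hli' hmem' hchain', ← hf]
  exact (forall_smul_mem_map_iff f hfi L x).symm

end Assembly

end QuadraticOrderLattice

end Literature.NumberTheory.QuadraticFields
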